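import Literature.NumberTheory.Irrationality.LaiLupuSprang2025.PhiFactor
import HarnessLib

/-!
# Lai–Lupu–Sprang 2025, Lemma 7.1: `max_i |ρ_i| ≤ 2^{sn}·p^{pn + o(n)}` — PROVED (termwise form)

Topic `Literature/NumberTheory/Irrationality/LaiLupuSprang2025`.  Source: L. Lai, C. Lupu, J. Sprang, *On the irrationality
of certain `p`-adic zeta values*, Res. Math. Sci. 12 (2025) = arXiv:2505.23088 [LaiLupuSprang2025], §7, Lemma 7.1 with
(r_ik_Archi) (held text `paper:arxiv-2505.23088`, chunk p0011, read on the page).  PROOF FILE (theorems only; no named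
fact, net debt 0): seventh file of the discharge of `PAdicZetaValues.laiLupuSprang2025_theorem11`, on `RationalFunction.lean`
(`RnReg`, `coeffR`, `rho`, `rhoZeroJ`, `rhoZero`), `PhiFactor.lean` (`coeffR_zero_right`) and the sibling discharge's
`TaylorBound` calculus (`Lai2025TwoAdic/GeneralRationalFunctionB.lean`).

## Source, as printed ([LaiLupuSprang2025, Lemma 7.1])

**Lemma 7.1.** «We have `max_{0≤i≤p−1+s} |ρ_i| ≤ 2^{sn}·p^{pn+o(n)}` as `n → ∞`.»  *Proof.* «We have `ρ_1 = 0` … `|ρ_i| ≤ Σ_{k=1}^n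
|r_{i,k}|` for `i ∈ {2,…,p−1+s}`, and `|ρ_0| ≤ Σ_j |ρ_{0,j/p}| ≤ Σ_j Σ_i Σ_k Σ_ν |r_{i,k}|/|ν+j/p|^i ≤ (p−1+s)²n²p^{p−1+s}·max|r_{i,k}|`.
It suffices to prove that `max_{i,k} |r_{i,k}| ≤ 2^{sn}·p^{pn+o(n)}` [(r_ik_Archi)].  … By (def:r_ik) and Cauchy's integral
formula … `|r_{i,k}| ≤ max_{|z+k|=1/(2p)} |R_n(z)|` … `≤ binom(n,k)^s·((pk)!/k!^p)((pn−pk)!/(n−k)!^p)·(2pn)^{3p+3s+M₀+2} ≤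
2^{sn}·p^{pk}·p^{pn−pk}·(2pn)^{3p+3s+M₀+2}`.»

DEVIATION (flagged, same as the sibling `Lai2025TwoAdic` discharge): instead of Cauchy's integral formula on `|z+k| = 1/(2p)`
the SAME exponential rate `2^{sn}p^{pn}` (with an explicit polynomial factor) is obtained from the termwise Taylor-coefficient
calculus `TaylorBound` applied to the brick form (5.1) of `R_n(t)(t+k)^{p−1+s}`: the value at `−k` is
`A·k^{M₀}·binom(n,k)^{p−1+s}·∏_j F_{j/p}(−k)` with `|∏_j F_{j/p}(−k)| ≤ (p^n p^{⌊n/(p−1)⌋} k!(n−k)!/n!)^{p−1}`, i.e.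
`≤ p^{pn}·k^{M₀}·binom(n,k)^s ≤ p^{pn}2^{sn}n^{M₀}`, and the rate is `≤ M₀ + 2n(p−1+s) + (p−1)pn`.

## What is formalised (all PROVED)

* `abs_prod_shift_le` (`|∏_{m<n}(−k + j/p + m)| ≤ k!(n−k)!`), `taylorBound_RnReg` (the geometric data of (5.1) at `−k`,
  `1 ≤ k ≤ n`), `abs_RnReg_neg_le` (`|R_n(t)(t+k)^{p−1+s}|_{t=−k}·… ≤ p^{pn}2^{sn}n^{M₀}`);
* **(r_ik_Archi), explicit**: `abs_coeffR_le` — `|r_{i,k}| ≤ 2^{sn}p^{pn}·n^{M₀}·(archRate p s n)^{p−1+s−i}` with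
  `archRate = M₀ + 2n(p−1+s) + (p−1)pn`, for all `k ≤ n` (`r_{i,0} = 0`);
* **Lemma 7.1, explicit**: `abs_rho_le` (`|ρ_i| ≤ (n+1)·2^{sn}p^{pn}n^{M₀}(archRate+1)^{p−1+s}`), `abs_rhoZero_le`
  (`|ρ_0| ≤ p(p+s)(n+1)²p^{p−1+s}·(the same)`), and the `o(n)` forms `eventually_abs_rho_le`, `eventually_abs_rhoZero_le`
  (`≤ 2^{sn}p^{pn}e^{εn}` for every `ε > 0`, all large `n`).

Cell zeta5-irr / pub-zeta5 (HONEST FRAMING: systematic search; no irrationality claim unless kernel-certified): Archimedean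
bookkeeping of a PUBLISHED proof; nothing here bears on `ζ(5) ∈ ℝ`.
-/

noncomputable section

open Finset Filter Topology Literature.Analysis.Calculus
open Literature.NumberTheory.Irrationality.RivoalZudilin2020 (Greg Greg_eq)
open Literature.NumberTheory.Irrationality.LaiSprangZudilin2026.Lemma53 (Greg_neg)
open Literature.NumberTheory.Irrationality.Lai2025TwoAdic (TaylorBound)
open scoped Nat

namespace Literature.NumberTheory.Irrationality.LaiLupuSprang2025

/-! ## §1. The geometric data of `R_n(t)(t+k)^{p−1+s}` at `t = −k` -/

/-- `|∏_{m<n}(−k + j/p + m)| ≤ k!(n−k)!` for `0 < j < p`, `k ≤ n` (each factor is bounded by the integer `k − m` resp.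
`m − k + 1`). [cite: LaiLupuSprang2025, Lemma 7.1 (proof: "|(pz)_{pn+1}| ≤ (pk+1)!(pn−pk+1)!")] -/
theorem abs_prod_shift_le {p : ℕ} (n : ℕ) {k : ℕ} (hk : k ≤ n) {j : ℕ} (hj : j ∈ Ico 1 p) :
    |∏ m ∈ range n, (-(k : ℚ) + ((j : ℚ) / p + m))| ≤ (k ! : ℚ) * ((n - k)! : ℚ) := by
  have hj1 : 1 ≤ j := (mem_Ico.1 hj).1
  have hjp : j < p := (mem_Ico.1 hj).2
  have hp0 : (0 : ℚ) < p := by exact_mod_cast (show 0 < p by omega)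
  have hq0 : (0 : ℚ) ≤ (j : ℚ) / p := by positivity
  have hq1 : (j : ℚ) / p ≤ 1 := by rw [div_le_one hp0]; exact_mod_cast hjp.le
  rw [abs_prod, ← prod_range_mul_prod_Ico _ hk]
  have h1 : ∏ m ∈ range k, |(-(k : ℚ) + ((j : ℚ) / p + m))| ≤ (k ! : ℚ) := by
    have hle : ∏ m ∈ range k, |(-(k : ℚ) + ((j : ℚ) / p + m))| ≤ ∏ m ∈ range k, ((k : ℚ) - m) := by
      refine prod_le_prod (fun m _ => abs_nonneg _) fun m hm => ?_
      have hm' : (m : ℚ) + 1 ≤ k := by exact_mod_cast (mem_range.1 hm)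
      rw [abs_le]; constructor <;> linarith
    refine hle.trans (le_of_eq ?_)
    rw [← prod_range_reflect, ← prod_range_add_one_eq_factorial, Nat.cast_prod]
    refine prod_congr rfl fun m hm => ?_
    have hm' := mem_range.1 hm
    rw [Nat.cast_sub (by omega : m ≤ k - 1), Nat.cast_sub (by omega : 1 ≤ k)]; push_cast; ring
  have h2 : ∏ m ∈ Ico k n, |(-(k : ℚ) + ((j : ℚ) / p + m))| ≤ ((n - k)! : ℚ) := by
    have hle : ∏ m ∈ Ico k n, |(-(k : ℚ) + ((j : ℚ) / p + m))| ≤ ∏ m ∈ Ico k n, ((m : ℚ) - k + 1) := by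
      refine prod_le_prod (fun m _ => abs_nonneg _) fun m hm => ?_
      have hm' : (k : ℚ) ≤ m := by exact_mod_cast (mem_Ico.1 hm).1
      rw [abs_le]; constructor <;> linarith
    refine hle.trans (le_of_eq ?_)
    rw [prod_Ico_eq_prod_range, ← prod_range_add_one_eq_factorial, Nat.cast_prod]
    refine prod_congr rfl fun m _ => ?_
    push_cast; ring
  have h20 : 0 ≤ ∏ m ∈ Ico k n, |(-(k : ℚ) + ((j : ℚ) / p + m))| := prod_nonneg fun _ _ => abs_nonneg _
  exact mul_le_mul h1 h2 h20 (by positivity)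

/-- The factors `−k + j/p + m` are non-zero (`0 < j < p`). [cite: LaiLupuSprang2025, Lemma 7.1 (proof)] -/
theorem neg_add_shift_ne_zero {p : ℕ} (k m : ℕ) {j : ℕ} (hj : j ∈ Ico 1 p) : (-(k : ℚ) + ((j : ℚ) / p + m)) ≠ 0 := by
  have hj1 : 1 ≤ j := (mem_Ico.1 hj).1
  have hjp : j < p := (mem_Ico.1 hj).2
  have hp0 : (0 : ℚ) < p := by exact_mod_cast (show 0 < p by omega)
  intro h
  have h' : (p : ℚ) * ((m : ℚ) - k) = -j := by
    field_simp at h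
    linarith
  have hint : (((p : ℤ) * ((m : ℤ) - (k : ℤ)) : ℤ) : ℚ) = ((-(j : ℤ) : ℤ) : ℚ) := by push_cast; linarith
  have hz : (p : ℤ) * ((m : ℤ) - (k : ℤ)) = -(j : ℤ) := by exact_mod_cast hint
  have hdvd : (p : ℤ) ∣ (j : ℤ) := by rw [← dvd_neg, ← hz]; exact dvd_mul_right _ _
  have := Int.le_of_dvd (by exact_mod_cast hj1) hdvd
  omega

/-- Each `|−k + j/p + m| ≥ 1/p`, so the rate of a linear brick is `≤ p`. [cite: LaiLupuSprang2025, Lemma 7.1 (proof: the circle |z+k| = 1/(2p))] -/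
theorem inv_abs_shift_le {p : ℕ} (k m : ℕ) {j : ℕ} (hj : j ∈ Ico 1 p) : |(-(k : ℚ) + ((j : ℚ) / p + m))|⁻¹ ≤ p := by
  have hj1 : 1 ≤ j := (mem_Ico.1 hj).1
  have hjp : j < p := (mem_Ico.1 hj).2
  have hp0 : (0 : ℚ) < p := by exact_mod_cast (show 0 < p by omega)
  have hne := neg_add_shift_ne_zero k m hj
  rw [inv_le_comm₀ (abs_pos.2 hne) hp0]
  -- `|p(m−k) + j| ≥ 1` as a non-zero integer
  have hint : (p : ℚ) * (-(k : ℚ) + ((j : ℚ) / p + m)) = (((p : ℤ) * ((m : ℤ) - k) + j : ℤ) : ℚ) := by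
    push_cast; field_simp; ring
  have hz : ((p : ℤ) * ((m : ℤ) - k) + j : ℤ) ≠ 0 := by
    intro h0
    apply hne
    have : (p : ℚ) * (-(k : ℚ) + ((j : ℚ) / p + m)) = 0 := by rw [hint, h0]; push_cast; ring
    rcases mul_eq_zero.1 this with h | h
    · exact absurd h hp0.ne'
    · exact h
  have h1 : (1 : ℚ) ≤ |(p : ℚ) * (-(k : ℚ) + ((j : ℚ) / p + m))| := by
    rw [hint, ← Int.cast_abs]; exact_mod_cast Int.one_le_abs hz
  rw [abs_mul, abs_of_pos hp0] at h1
  calc (p : ℚ)⁻¹ = (p : ℚ)⁻¹ * 1 := (mul_one _).symm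
    _ ≤ (p : ℚ)⁻¹ * ((p : ℚ) * |(-(k : ℚ) + ((j : ℚ) / p + m))|) := by gcongr
    _ = |(-(k : ℚ) + ((j : ℚ) / p + m))| := by field_simp

/-- The rate of the geometric data of (5.1) at `−k`: `M₀ + 2n(p−1+s) + (p−1)·p·n` (a crude bound for
`M₀/k + (p−1+s)Σ_{l≠k}|l−k|^{−1} + Σ_{j,m}|m−k+j/p|^{−1}`). [cite: LaiLupuSprang2025, Lemma 7.1 (proof)] -/
def archRate (p s n : ℕ) : ℚ := (M0 p s : ℚ) + 2 * n * (p - 1 + s : ℕ) + (p - 1 : ℕ) * p * n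

/-- `archRate ≥ 0`. [cite: LaiLupuSprang2025, Lemma 7.1 (proof)] -/
theorem archRate_nonneg (p s n : ℕ) : 0 ≤ archRate p s n := by unfold archRate; positivity

/-- `|l − k| ≥ 1` for integers `l ≠ k`. [cite: LaiLupuSprang2025, Lemma 7.1 (proof)] -/
theorem one_le_abs_neg_add {k l : ℕ} (hlk : l ≠ k) : (1 : ℚ) ≤ |(-(k : ℚ)) + l| := by
  have hz : ((l : ℤ) - (k : ℤ)) ≠ 0 := sub_ne_zero.2 (by exact_mod_cast hlk)
  have h := Int.one_le_abs hz
  rw [show (-(k : ℚ)) + l = ((((l : ℤ) - (k : ℤ)) : ℤ) : ℚ) by push_cast; ring, ← Int.cast_abs,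
    show (1 : ℚ) = ((1 : ℤ) : ℚ) by norm_num]
  exact_mod_cast h

/-- `Σ_{l ≤ n, l ≠ k} |l − k|^{−1} ≤ 2n` (each term `≤ 1`; `k ≤ n`). [cite: LaiLupuSprang2025, Lemma 7.1 (proof)] -/
theorem sum_inv_abs_sub_le (n : ℕ) {k : ℕ} (hk : k ≤ n) :
    ∑ l ∈ (range (n + 1)).filter (fun l => l ≠ k), |(-(k : ℚ)) + l|⁻¹ ≤ 2 * n := by
  have hterm : ∀ l ∈ (range (n + 1)).filter (fun l => l ≠ k), |(-(k : ℚ)) + l|⁻¹ ≤ 1 := by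
    intro l hl
    exact inv_le_one_of_one_le₀ (one_le_abs_neg_add (mem_filter.1 hl).2)
  calc ∑ l ∈ (range (n + 1)).filter (fun l => l ≠ k), |(-(k : ℚ)) + l|⁻¹
      ≤ ∑ l ∈ (range (n + 1)).filter (fun l => l ≠ k), (1 : ℚ) := sum_le_sum hterm
    _ = (((range (n + 1)).filter (fun l => l ≠ k)).card : ℚ) := by simp
    _ ≤ 2 * n := by
        have hcard : ((range (n + 1)).filter (fun l => l ≠ k)).card = n := by
          rw [Finset.filter_ne', card_erase_of_mem (mem_range.2 (by omega)), card_range, Nat.add_sub_cancel]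
        rw [hcard]
        have : (0 : ℚ) ≤ n := Nat.cast_nonneg n
        linarith

/-- **The geometric data of `R_n(t)(t+k)^{p−1+s}` (5.1) at `−k`, `1 ≤ k ≤ n`**: value bound
`p^{pn}·k^{M₀}·binom(n,k)^s·… ≤ p^{pn}2^{sn}n^{M₀}` and rate `≤ archRate`. [cite: LaiLupuSprang2025, Lemma 7.1 (proof, (r_ik_Archi))] -/
theorem taylorBound_RnReg {p : ℕ} (hp : 2 ≤ p) (s n : ℕ) {k : ℕ} (hk1 : 1 ≤ k) (hk : k ≤ n) (N : ℕ) :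
    TaylorBound N (RnReg p s n k) (-(k : ℚ)) ((p : ℚ) ^ (p * n) * 2 ^ (s * n) * (n : ℚ) ^ M0 p s) (archRate p s n) := by
  classical
  set x : ℚ := -(k : ℚ) with hx
  have hk0 : (0 : ℚ) < k := by exact_mod_cast hk1
  have hxne : x + 0 ≠ 0 := by rw [hx, add_zero, neg_ne_zero]; exact hk0.ne'
  have hxabs : |x + 0| = k := by rw [hx, add_zero, abs_neg, abs_of_pos hk0]
  -- the four blocks of (5.1)
  have hA := TaylorBound.const N x (Acst p n : ℚ)
  have hT := (TaylorBound.linear N (0 : ℚ) hxne).pow (M0 p s)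
  have hC := TaylorBound.const N x (n ! : ℚ)
  have hint : ∀ l ∈ (range (n + 1)).filter (fun l => l ≠ k), x + (l : ℚ) ≠ 0 := fun l hl => by
    rw [hx]
    exact abs_pos.1 (lt_of_lt_of_le one_pos (one_le_abs_neg_add (mem_filter.1 hl).2))
  have hD := TaylorBound.finset_prod (N := N) (x := x) ((range (n + 1)).filter (fun l => l ≠ k))
    (F := fun l t => (t + (l : ℚ))⁻¹) (fun l hl => TaylorBound.invLinear N _ (hint l hl))
  have hG : TaylorBound N (Greg n k) x _ _ := (hC.mul hD).congr (Eventually.of_forall fun t =>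
    (Greg_eq n hk t).symm)
  have hGA := hG.pow (p - 1 + s)
  have hFj : ∀ j ∈ Ico 1 p, TaylorBound N (pBrick p j n) x
      (|(p : ℚ) ^ n * (p : ℚ) ^ (n / (p - 1)) / (n ! : ℚ)| * ∏ m ∈ range n, |x + ((j : ℚ) / p + m)|)
      (0 + ∑ m ∈ range n, |x + ((j : ℚ) / p + m)|⁻¹) := by
    intro j hj
    have hK := TaylorBound.const N x ((p : ℚ) ^ n * (p : ℚ) ^ (n / (p - 1)) / (n ! : ℚ))
    have hL := TaylorBound.finset_prod (N := N) (x := x) (range n) (F := fun m t => t + ((j : ℚ) / p + m))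
      (fun m _ => TaylorBound.linear N _ (by rw [hx]; exact neg_add_shift_ne_zero k m hj))
    exact (hK.mul hL).congr (Eventually.of_forall fun t => by rw [pBrick])
  have hF := TaylorBound.finset_prod (N := N) (x := x) (Ico 1 p) hFj
  have hR := ((hA.mul hT).mul hGA).mul hF
  have hR' : TaylorBound N (RnReg p s n k) x _ _ := hR.congr (Eventually.of_forall fun t => by
    simp only [RnReg, add_zero])
  refine hR'.mono ?_ ?_
  · -- the value: `A k^{M₀} (n!/(k!(n−k)!))^{p−1+s} ∏_j (p^n p^{⌊n/(p−1)⌋}/n! · |∏_m(−k+j/p+m)|) ≤ p^{pn} 2^{sn} n^{M₀}`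
    have hf : (0 : ℚ) < n ! := by exact_mod_cast Nat.factorial_pos n
    have hkf : (0 : ℚ) < k ! := by exact_mod_cast Nat.factorial_pos k
    have hnkf : (0 : ℚ) < (n - k)! := by exact_mod_cast Nat.factorial_pos (n - k)
    have hp0 : (0 : ℚ) < p := by exact_mod_cast (show 0 < p by omega)
    have hGval : |(n ! : ℚ)| * ∏ l ∈ (range (n + 1)).filter (fun l => l ≠ k), |x + (l : ℚ)|⁻¹ =
        (n ! : ℚ) / ((k ! : ℚ) * ((n - k)! : ℚ)) := by
      have h1 : |(n ! : ℚ)| * ∏ l ∈ (range (n + 1)).filter (fun l => l ≠ k), |x + (l : ℚ)|⁻¹ = |Greg n k x| := by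
        rw [Greg_eq n hk x, abs_mul, abs_prod]
        exact congrArg _ (prod_congr rfl fun l _ => (abs_inv _).symm)
      rw [h1, hx, Greg_neg n hk, abs_div, abs_mul, abs_pow, abs_neg, abs_one, one_pow, one_mul, abs_of_pos hf,
        abs_of_pos (by positivity)]
    have hchoose : (n ! : ℚ) / ((k ! : ℚ) * ((n - k)! : ℚ)) = (n.choose k : ℚ) := by
      rw [div_eq_iff (by positivity)]
      have := Nat.choose_mul_factorial_mul_factorial hk
      rw [← this]; push_cast; ring
    have hFval : ∀ j ∈ Ico 1 p, |(p : ℚ) ^ n * (p : ℚ) ^ (n / (p - 1)) / (n ! : ℚ)| *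
        ∏ m ∈ range n, |x + ((j : ℚ) / p + m)| ≤
        (p : ℚ) ^ n * (p : ℚ) ^ (n / (p - 1)) / (n ! : ℚ) * ((k ! : ℚ) * ((n - k)! : ℚ)) := by
      intro j hj
      rw [abs_of_pos (by positivity), ← abs_prod]
      exact mul_le_mul_of_nonneg_left (by rw [hx]; exact abs_prod_shift_le n hk hj) (by positivity)
    have hFprod : ∏ j ∈ Ico 1 p, (|(p : ℚ) ^ n * (p : ℚ) ^ (n / (p - 1)) / (n ! : ℚ)| *
        ∏ m ∈ range n, |x + ((j : ℚ) / p + m)|) ≤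
        ((p : ℚ) ^ n * (p : ℚ) ^ (n / (p - 1)) / (n ! : ℚ) * ((k ! : ℚ) * ((n - k)! : ℚ))) ^ (p - 1) := by
      have h := Finset.prod_le_prod (s := Ico 1 p) (fun j _ => mul_nonneg (abs_nonneg _)
        (prod_nonneg fun m _ => abs_nonneg _)) hFval
      rwa [prod_const, Nat.card_Ico] at h
    rw [hxabs, hGval, hchoose]
    have hchoose_le : (n.choose k : ℚ) ≤ 2 ^ n := by exact_mod_cast Nat.choose_le_two_pow n k
    have hkn : (k : ℚ) ≤ n := by exact_mod_cast hk
    have hAcst : 0 ≤ (Acst p n : ℚ) := by positivity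
    -- `A (p^n p^{⌊n/(p−1)⌋})^{p−1} = p^{pn}` and `binom · (k!(n−k)!/n!) = 1`
    have hkey : |(Acst p n : ℚ)| * (k : ℚ) ^ M0 p s * (n.choose k : ℚ) ^ (p - 1 + s) *
        ((p : ℚ) ^ n * (p : ℚ) ^ (n / (p - 1)) / (n ! : ℚ) * ((k ! : ℚ) * ((n - k)! : ℚ))) ^ (p - 1) =
        (p : ℚ) ^ (p * n) * (n.choose k : ℚ) ^ s * (k : ℚ) ^ M0 p s := by
      have hf' : (n ! : ℚ) ≠ 0 := hf.ne'
      have hkf' : (k ! : ℚ) ≠ 0 := hkf.ne'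
      have hnkf' : ((n - k)! : ℚ) ≠ 0 := hnkf.ne'
      rw [abs_of_nonneg hAcst, pow_mul_eq_Acst_mul (by omega : 1 ≤ p) n, ← hchoose, pow_add]
      have e1 : ((p : ℚ) ^ n * (p : ℚ) ^ (n / (p - 1)) / (n ! : ℚ) * ((k ! : ℚ) * ((n - k)! : ℚ))) ^ (p - 1) =
          ((p : ℚ) ^ n * (p : ℚ) ^ (n / (p - 1))) ^ (p - 1) * (((k ! : ℚ) * ((n - k)! : ℚ)) / (n ! : ℚ)) ^ (p - 1) := by
        rw [← mul_pow]; congr 1; field_simp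
      have e2 : ((n ! : ℚ) / ((k ! : ℚ) * ((n - k)! : ℚ))) ^ (p - 1) * (((k ! : ℚ) * ((n - k)! : ℚ)) / (n ! : ℚ)) ^ (p - 1) = 1 := by
        rw [← mul_pow, div_mul_div_comm, mul_comm ((k ! : ℚ) * ((n - k)! : ℚ)) (n ! : ℚ),
          div_self (by positivity : ((n ! : ℚ) * ((k ! : ℚ) * ((n - k)! : ℚ))) ≠ 0), one_pow]
      rw [e1]
      linear_combination ((Acst p n : ℚ) * (k : ℚ) ^ M0 p s * ((n ! : ℚ) / ((k ! : ℚ) * ((n - k)! : ℚ))) ^ s *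
        ((p : ℚ) ^ n * (p : ℚ) ^ (n / (p - 1))) ^ (p - 1)) * e2
    calc |(Acst p n : ℚ)| * (k : ℚ) ^ M0 p s * ((n.choose k : ℚ)) ^ (p - 1 + s) *
          ∏ j ∈ Ico 1 p, (|(p : ℚ) ^ n * (p : ℚ) ^ (n / (p - 1)) / (n ! : ℚ)| * ∏ m ∈ range n, |x + ((j : ℚ) / p + m)|)
        ≤ |(Acst p n : ℚ)| * (k : ℚ) ^ M0 p s * ((n.choose k : ℚ)) ^ (p - 1 + s) *
          ((p : ℚ) ^ n * (p : ℚ) ^ (n / (p - 1)) / (n ! : ℚ) * ((k ! : ℚ) * ((n - k)! : ℚ))) ^ (p - 1) :=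
          mul_le_mul_of_nonneg_left hFprod (by positivity)
      _ = (p : ℚ) ^ (p * n) * (n.choose k : ℚ) ^ s * (k : ℚ) ^ M0 p s := hkey
      _ ≤ (p : ℚ) ^ (p * n) * (2 ^ n) ^ s * (n : ℚ) ^ M0 p s := by gcongr
      _ = (p : ℚ) ^ (p * n) * 2 ^ (s * n) * (n : ℚ) ^ M0 p s := by rw [← pow_mul, mul_comm n s]
  · -- the rate
    have h1 : (M0 p s : ℚ) * |x + 0|⁻¹ ≤ M0 p s := by
      rw [hxabs]
      have : (k : ℚ)⁻¹ ≤ 1 := inv_le_one_of_one_le₀ (by exact_mod_cast hk1)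
      calc (M0 p s : ℚ) * (k : ℚ)⁻¹ ≤ (M0 p s : ℚ) * 1 := by gcongr
        _ = M0 p s := mul_one _
    have h2 : ((p - 1 + s : ℕ) : ℚ) * (0 + ∑ l ∈ (range (n + 1)).filter (fun l => l ≠ k), |x + (l : ℚ)|⁻¹) ≤
        2 * n * (p - 1 + s : ℕ) := by
      rw [zero_add, hx]
      calc ((p - 1 + s : ℕ) : ℚ) * ∑ l ∈ (range (n + 1)).filter (fun l => l ≠ k), |(-(k : ℚ)) + (l : ℚ)|⁻¹
          ≤ ((p - 1 + s : ℕ) : ℚ) * (2 * n) := mul_le_mul_of_nonneg_left (sum_inv_abs_sub_le n hk) (by positivity)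
        _ = 2 * n * (p - 1 + s : ℕ) := by ring
    have h3 : ∑ j ∈ Ico 1 p, (0 + ∑ m ∈ range n, |x + ((j : ℚ) / p + m)|⁻¹) ≤ ((p - 1 : ℕ) : ℚ) * p * n := by
      have hj : ∀ j ∈ Ico 1 p, (0 + ∑ m ∈ range n, |x + ((j : ℚ) / p + m)|⁻¹) ≤ (n : ℚ) * p := by
        intro j hj
        rw [zero_add]
        calc ∑ m ∈ range n, |x + ((j : ℚ) / p + m)|⁻¹ ≤ ∑ m ∈ range n, (p : ℚ) :=
              sum_le_sum fun m _ => by rw [hx]; exact inv_abs_shift_le k m hj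
          _ = (n : ℚ) * p := by simp
      calc ∑ j ∈ Ico 1 p, (0 + ∑ m ∈ range n, |x + ((j : ℚ) / p + m)|⁻¹) ≤ ∑ j ∈ Ico 1 p, (n : ℚ) * p := sum_le_sum hj
        _ = ((p - 1 : ℕ) : ℚ) * p * n := by rw [sum_const, Nat.card_Ico]; ring
    calc (0 : ℚ) + (M0 p s : ℕ) * |x + 0|⁻¹ +
          (p - 1 + s : ℕ) * (0 + ∑ l ∈ (range (n + 1)).filter (fun l => l ≠ k), |x + (l : ℚ)|⁻¹) +
          ∑ j ∈ Ico 1 p, (0 + ∑ m ∈ range n, |x + ((j : ℚ) / p + m)|⁻¹)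
        ≤ 0 + (M0 p s : ℚ) + 2 * n * (p - 1 + s : ℕ) + ((p - 1 : ℕ) : ℚ) * p * n := by gcongr
      _ = archRate p s n := by rw [archRate, zero_add]

/-! ## §2. (r_ik_Archi) and Lemma 7.1 in explicit form -/

/-- The common Archimedean majorant `2^{sn}p^{pn}·n^{M₀}·(archRate + 1)^{p−1+s}`. [cite: LaiLupuSprang2025, Lemma 7.1 (r_ik_Archi)] -/
def archBound (p s n : ℕ) : ℚ :=
  (p : ℚ) ^ (p * n) * 2 ^ (s * n) * (n : ℚ) ^ M0 p s * (archRate p s n + 1) ^ (p - 1 + s)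

/-- `archBound ≥ 0`. [cite: LaiLupuSprang2025, Lemma 7.1] -/
theorem archBound_nonneg (p s n : ℕ) : 0 ≤ archBound p s n := by
  have := archRate_nonneg p s n
  unfold archBound; positivity

/-- **(r_ik_Archi), explicit: `|r_{i,k}| ≤ 2^{sn}p^{pn}·n^{M₀}·(archRate+1)^{p−1+s}`** for all `k ≤ n` (`r_{i,0} = 0`).
[cite: LaiLupuSprang2025, Lemma 7.1 (r_ik_Archi)] -/
theorem abs_coeffR_le {p : ℕ} (hp : p.Prime) {s : ℕ} (hs : 1 ≤ s) (n i : ℕ) {k : ℕ} (hk : k ≤ n) :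
    |coeffR p s n i k| ≤ archBound p s n := by
  rcases Nat.eq_zero_or_pos k with rfl | hk1
  · rw [coeffR_zero_right hp.two_le hs n i, abs_zero]; exact archBound_nonneg p s n
  have hT := taylorBound_RnReg hp.two_le s n hk1 hk (p - 1 + s - i)
  have h := hT.bound (p - 1 + s - i) le_rfl
  rw [coeffR]
  refine h.trans ?_
  unfold archBound
  have hr := archRate_nonneg p s n
  have h1 : archRate p s n ^ (p - 1 + s - i) ≤ (archRate p s n + 1) ^ (p - 1 + s) :=
    calc archRate p s n ^ (p - 1 + s - i) ≤ (archRate p s n + 1) ^ (p - 1 + s - i) :=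
          pow_le_pow_left₀ hr (by linarith) _
      _ ≤ (archRate p s n + 1) ^ (p - 1 + s) := pow_le_pow_right₀ (by linarith) (Nat.sub_le _ _)
  exact mul_le_mul_of_nonneg_left h1 (by positivity)

/-- **Lemma 7.1 for `i ≥ 1`, explicit: `|ρ_i| ≤ (n+1)·archBound`.** [cite: LaiLupuSprang2025, Lemma 7.1 ("|ρ_i| ≤ Σ_k |r_{i,k}|")] -/
theorem abs_rho_le {p : ℕ} (hp : p.Prime) {s : ℕ} (hs : 1 ≤ s) (n i : ℕ) :
    |rho p s n i| ≤ ((n : ℚ) + 1) * archBound p s n := by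
  rw [rho]
  calc |∑ k ∈ range (n + 1), coeffR p s n i k| ≤ ∑ k ∈ range (n + 1), |coeffR p s n i k| := abs_sum_le_sum_abs _ _
    _ ≤ ∑ k ∈ range (n + 1), archBound p s n :=
        sum_le_sum fun k hk => abs_coeffR_le hp hs n i (by have := mem_range.1 hk; omega)
    _ = ((n : ℚ) + 1) * archBound p s n := by rw [sum_const, card_range, nsmul_eq_mul]; push_cast; ring

/-- `|ν + j/p|^{−i} ≤ p^i ≤ p^{p−1+s}` for `i ≤ p−1+s`, `1 ≤ j`. [cite: LaiLupuSprang2025, Lemma 7.1 ("≤ (p−1+s)²n²p^{p−1+s}·max|r_{i,k}|")] -/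
theorem inv_pow_shift_le {p s : ℕ} (hp : 2 ≤ p) {j : ℕ} (hj : 1 ≤ j) (ν : ℕ) {i : ℕ} (hi : i ≤ p - 1 + s) :
    |(((ν : ℚ) + (j : ℚ) / p) ^ i)⁻¹| ≤ (p : ℚ) ^ (p - 1 + s) := by
  have hp0 : (0 : ℚ) < p := by exact_mod_cast (show 0 < p by omega)
  have hp1 : (1 : ℚ) ≤ p := by exact_mod_cast (show 1 ≤ p by omega)
  have hbase : (p : ℚ)⁻¹ ≤ (ν : ℚ) + (j : ℚ) / p := by
    have : (p : ℚ)⁻¹ ≤ (j : ℚ) / p := by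
      rw [inv_eq_one_div]; exact div_le_div_of_nonneg_right (by exact_mod_cast hj) hp0.le
    linarith [(Nat.cast_nonneg ν : (0 : ℚ) ≤ ν)]
  have hpos : (0 : ℚ) < (ν : ℚ) + (j : ℚ) / p := lt_of_lt_of_le (by positivity) hbase
  rw [abs_inv, abs_pow, abs_of_pos hpos, ← inv_pow]
  calc ((ν : ℚ) + (j : ℚ) / p)⁻¹ ^ i ≤ (p : ℚ) ^ i := by
        refine pow_le_pow_left₀ (by positivity) ?_ _
        rw [inv_le_comm₀ hpos hp0]; exact hbase
    _ ≤ (p : ℚ) ^ (p - 1 + s) := pow_le_pow_right₀ hp1 hi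

/-- **Lemma 7.1 for `ρ_{0,j/p}`, explicit**: `|ρ_{0,j/p}| ≤ (p+s)(n+1)²p^{p−1+s}·archBound`.
[cite: LaiLupuSprang2025, Lemma 7.1 ("|ρ_0| ≤ Σ_j |ρ_{0,j/p}| ≤ … ≤ (p−1+s)²n²p^{p−1+s}·max|r_{i,k}|")] -/
theorem abs_rhoZeroJ_le {p : ℕ} (hp : p.Prime) {s : ℕ} (hs : 1 ≤ s) (n : ℕ) {j : ℕ} (hj : j ∈ Ico 1 p) :
    |rhoZeroJ p s n j| ≤ ((p - 1 + s : ℕ) : ℚ) * (((n : ℚ) + 1) * ((n : ℚ) + 1)) * (p : ℚ) ^ (p - 1 + s) *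
      archBound p s n := by
  have hj1 : 1 ≤ j := (mem_Ico.1 hj).1
  have hB := archBound_nonneg p s n
  rw [rhoZeroJ, abs_neg]
  have hterm : ∀ i ∈ Icc 1 (p - 1 + s), ∀ k ∈ range (n + 1), ∀ ν ∈ range k,
      |coeffR p s n i k / ((ν : ℚ) + (j : ℚ) / p) ^ i| ≤ (p : ℚ) ^ (p - 1 + s) * archBound p s n := by
    intro i hi k hk ν _
    rw [div_eq_mul_inv, abs_mul, mul_comm]
    exact mul_le_mul (inv_pow_shift_le (s := s) hp.two_le hj1 ν (mem_Icc.1 hi).2)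
      (abs_coeffR_le hp hs n i (by have := mem_range.1 hk; omega)) (abs_nonneg _) (by positivity)
  calc |∑ i ∈ Icc 1 (p - 1 + s), ∑ k ∈ range (n + 1), ∑ ν ∈ range k, coeffR p s n i k / ((ν : ℚ) + (j : ℚ) / p) ^ i|
      ≤ ∑ i ∈ Icc 1 (p - 1 + s), ∑ k ∈ range (n + 1), ∑ ν ∈ range k,
          |coeffR p s n i k / ((ν : ℚ) + (j : ℚ) / p) ^ i| := by
        refine (abs_sum_le_sum_abs _ _).trans (sum_le_sum fun i _ => ?_)
        refine (abs_sum_le_sum_abs _ _).trans (sum_le_sum fun k _ => ?_)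
        exact abs_sum_le_sum_abs _ _
    _ ≤ ∑ i ∈ Icc 1 (p - 1 + s), ∑ k ∈ range (n + 1), ∑ _ν ∈ range k, (p : ℚ) ^ (p - 1 + s) * archBound p s n :=
        sum_le_sum fun i hi => sum_le_sum fun k hk => sum_le_sum fun ν hν => hterm i hi k hk ν hν
    _ ≤ ∑ i ∈ Icc 1 (p - 1 + s), ∑ k ∈ range (n + 1), ((n : ℚ) + 1) * ((p : ℚ) ^ (p - 1 + s) * archBound p s n) := by
        refine sum_le_sum fun i _ => sum_le_sum fun k hk => ?_
        rw [sum_const, card_range, nsmul_eq_mul]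
        refine mul_le_mul_of_nonneg_right ?_ (by positivity)
        have := mem_range.1 hk
        exact_mod_cast (show k ≤ n + 1 by omega)
    _ = ((p - 1 + s : ℕ) : ℚ) * (((n : ℚ) + 1) * ((n : ℚ) + 1)) * (p : ℚ) ^ (p - 1 + s) * archBound p s n := by
        rw [sum_const, sum_const, card_range, Nat.card_Icc, nsmul_eq_mul, nsmul_eq_mul,
          show p - 1 + s + 1 - 1 = p - 1 + s by omega]
        push_cast
        ring

/-- **Lemma 7.1 for `ρ_0`, explicit**: `|ρ_0| ≤ (p−1)(p−1+s)(n+1)²p^{p−1+s}·archBound`.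
[cite: LaiLupuSprang2025, Lemma 7.1 ("|ρ_0| ≤ … (p−1+s)²n²p^{p−1+s}·max|r_{i,k}|")] -/
theorem abs_rhoZero_le {p : ℕ} (hp : p.Prime) {s : ℕ} (hs : 1 ≤ s) (n : ℕ) :
    |rhoZero p s n| ≤ ((p - 1 : ℕ) : ℚ) * (((p - 1 + s : ℕ) : ℚ) * (((n : ℚ) + 1) * ((n : ℚ) + 1)) *
      (p : ℚ) ^ (p - 1 + s) * archBound p s n) := by
  rw [rhoZero]
  calc |∑ j ∈ Ico 1 p, rhoZeroJ p s n j| ≤ ∑ j ∈ Ico 1 p, |rhoZeroJ p s n j| := abs_sum_le_sum_abs _ _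
    _ ≤ ∑ j ∈ Ico 1 p, ((p - 1 + s : ℕ) : ℚ) * (((n : ℚ) + 1) * ((n : ℚ) + 1)) * (p : ℚ) ^ (p - 1 + s) *
          archBound p s n := sum_le_sum fun j hj => abs_rhoZeroJ_le hp hs n hj
    _ = _ := by rw [sum_const, Nat.card_Ico, nsmul_eq_mul]

/-! ## §3. The `o(n)` forms -/

/-- A polynomial is `e^{o(n)}`: for `ε > 0` and constants `C, K`, eventually `C·(n+1)^K ≤ e^{εn}`.
[cite: LaiLupuSprang2025, Lemma 7.1 ("(2pn)^{3p+3s+M_0+2} = p^{o(n)}")] -/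
theorem eventually_poly_le_exp {C : ℝ} (K : ℕ) {ε : ℝ} (hε : 0 < ε) :
    ∀ᶠ n : ℕ in atTop, C * ((n : ℝ) + 1) ^ K ≤ Real.exp (ε * n) := by
  -- `(n+1)^{K+1} = o(e^{εn})`, and `C (n+1)^K ≤ (n+1)^{K+1}` for `n + 1 ≥ C`
  have h1 : Tendsto (fun x : ℝ => x ^ ((K : ℝ) + 1) * Real.exp (-ε * x)) atTop (𝓝 0) :=
    tendsto_rpow_mul_exp_neg_mul_atTop_nhds_zero ((K : ℝ) + 1) ε hε
  have h2 : Tendsto (fun n : ℕ => ((n : ℝ) + 1) ^ ((K : ℝ) + 1) * Real.exp (-ε * ((n : ℝ) + 1))) atTop (𝓝 0) := by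
    have ht : Tendsto (fun n : ℕ => (n : ℝ) + 1) atTop atTop :=
      tendsto_natCast_atTop_atTop.atTop_add tendsto_const_nhds
    exact h1.comp ht
  have h3 := h2.eventually (gt_mem_nhds (show (0 : ℝ) < Real.exp (-ε) by positivity))
  have hC := tendsto_natCast_atTop_atTop.eventually_ge_atTop (max C 0)
  filter_upwards [h3, hC] with n hn hnC
  have hn0 : (0 : ℝ) < (n : ℝ) + 1 := by positivity
  have hCle : C ≤ (n : ℝ) + 1 := by linarith [le_max_left C 0]
  rw [Real.rpow_add hn0, Real.rpow_natCast, Real.rpow_one] at hn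
  -- `(n+1)^{K+1} e^{−ε(n+1)} < e^{−ε}` ⇒ `(n+1)^{K+1} < e^{εn}`
  have hexp : Real.exp (-ε * ((n : ℝ) + 1)) = Real.exp (-ε) * (Real.exp (ε * n))⁻¹ := by
    rw [← Real.exp_neg, ← Real.exp_add]; congr 1; ring
  rw [hexp] at hn
  have hE : 0 < Real.exp (ε * n) := Real.exp_pos _
  have hkey : ((n : ℝ) + 1) ^ K * ((n : ℝ) + 1) < Real.exp (ε * n) := by
    have := (mul_lt_iff_lt_one_right (Real.exp_pos (-ε))).1
      (by calc Real.exp (-ε) * (((n : ℝ) + 1) ^ K * ((n : ℝ) + 1) * (Real.exp (ε * n))⁻¹)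
            = ((n : ℝ) + 1) ^ K * ((n : ℝ) + 1) * (Real.exp (-ε) * (Real.exp (ε * n))⁻¹) := by ring
          _ < Real.exp (-ε) := hn)
    rwa [mul_inv_lt_iff₀ hE, one_mul] at this
  calc C * ((n : ℝ) + 1) ^ K ≤ ((n : ℝ) + 1) * ((n : ℝ) + 1) ^ K :=
        mul_le_mul_of_nonneg_right hCle (by positivity)
    _ = ((n : ℝ) + 1) ^ K * ((n : ℝ) + 1) := mul_comm _ _
    _ ≤ Real.exp (ε * n) := hkey.le

/-- `archBound` and its polynomial prefactors are `2^{sn}p^{pn}·e^{o(n)}`: for `ε > 0`, eventually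
`P(n)·archBound ≤ 2^{sn}p^{pn}e^{εn}` for the polynomial prefactor `P(n) = p(p+s)(n+1)²p^{p−1+s}` of `ρ_0` (which
dominates those of the `ρ_i`). [cite: LaiLupuSprang2025, Lemma 7.1] -/
theorem eventually_archBound_le {p : ℕ} (hp : 2 ≤ p) (s : ℕ) {ε : ℝ} (hε : 0 < ε) :
    ∀ᶠ n : ℕ in atTop, ((((p - 1 : ℕ) : ℚ) * (((p - 1 + s : ℕ) : ℚ) * (((n : ℚ) + 1) * ((n : ℚ) + 1)) *
      (p : ℚ) ^ (p - 1 + s) * archBound p s n) : ℚ) : ℝ) ≤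
        (2 : ℝ) ^ (s * n) * (p : ℝ) ^ (p * n) * Real.exp (ε * n) := by
  -- the rate `archRate + 1 ≤ R·(n+1)` with `R = M₀ + 2(p−1+s) + (p−1)p + 1`
  set R : ℝ := (M0 p s : ℝ) + 2 * (((p - 1 : ℕ) : ℝ) + s) + ((p - 1 : ℕ) : ℝ) * p + 1 with hR
  have hR0 : 0 ≤ R := by positivity
  set K : ℕ := 2 + M0 p s + (p - 1 + s) with hK
  set C : ℝ := ((p - 1 : ℕ) : ℝ) * (((p - 1 : ℕ) : ℝ) + s) * (p : ℝ) ^ (p - 1 + s) * R ^ (p - 1 + s) with hC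
  filter_upwards [eventually_poly_le_exp (C := C) K hε] with n hn
  have hn0 : (0 : ℝ) ≤ n := Nat.cast_nonneg n
  have hrate : ((archRate p s n + 1 : ℚ) : ℝ) ≤ R * ((n : ℝ) + 1) := by
    rw [archRate]; push_cast; rw [hR]
    have hM0 : (0 : ℝ) ≤ (M0 p s : ℝ) := by positivity
    have hq : (0 : ℝ) ≤ ((p - 1 : ℕ) : ℝ) := by positivity
    have hs0 : (0 : ℝ) ≤ (s : ℝ) := by positivity
    have hp0 : (0 : ℝ) ≤ (p : ℝ) := by positivity
    nlinarith [mul_nonneg hM0 hn0, mul_nonneg hq hp0, mul_nonneg hq hs0]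
  have hrate0 : (0 : ℝ) ≤ ((archRate p s n + 1 : ℚ) : ℝ) := by
    have := archRate_nonneg p s n; exact_mod_cast (by linarith : (0 : ℚ) ≤ archRate p s n + 1)
  have hnM : (n : ℝ) ^ M0 p s ≤ ((n : ℝ) + 1) ^ M0 p s := pow_le_pow_left₀ hn0 (by linarith) _
  -- assemble
  have hlhs : ((((p - 1 : ℕ) : ℚ) * (((p - 1 + s : ℕ) : ℚ) * (((n : ℚ) + 1) * ((n : ℚ) + 1)) *
      (p : ℚ) ^ (p - 1 + s) * archBound p s n) : ℚ) : ℝ) =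
      (2 : ℝ) ^ (s * n) * (p : ℝ) ^ (p * n) * (((p - 1 : ℕ) : ℝ) * (((p - 1 : ℕ) : ℝ) + s) * (p : ℝ) ^ (p - 1 + s) *
        (((n : ℝ) + 1) ^ 2 * (n : ℝ) ^ M0 p s * ((archRate p s n + 1 : ℚ) : ℝ) ^ (p - 1 + s))) := by
    rw [archBound]; push_cast; ring
  rw [hlhs]
  refine mul_le_mul_of_nonneg_left ?_ (by positivity)
  calc ((p - 1 : ℕ) : ℝ) * (((p - 1 : ℕ) : ℝ) + s) * (p : ℝ) ^ (p - 1 + s) *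
        (((n : ℝ) + 1) ^ 2 * (n : ℝ) ^ M0 p s * ((archRate p s n + 1 : ℚ) : ℝ) ^ (p - 1 + s))
      ≤ ((p - 1 : ℕ) : ℝ) * (((p - 1 : ℕ) : ℝ) + s) * (p : ℝ) ^ (p - 1 + s) *
        (((n : ℝ) + 1) ^ 2 * ((n : ℝ) + 1) ^ M0 p s * (R * ((n : ℝ) + 1)) ^ (p - 1 + s)) := by
        gcongr
    _ = C * ((n : ℝ) + 1) ^ K := by rw [hC, hK, mul_pow]; ring
    _ ≤ Real.exp (ε * n) := hn

/-- **Lemma 7.1 (`o(n)` form): for every `ε > 0`, for all large `n`: `|ρ_0| ≤ 2^{sn}p^{pn}e^{εn}` and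
`|ρ_i| ≤ 2^{sn}p^{pn}e^{εn}` for all `i`.** [cite: LaiLupuSprang2025, Lemma 7.1] -/
theorem eventually_abs_rho_le {p : ℕ} (hp : p.Prime) {s : ℕ} (hs : 1 ≤ s) {ε : ℝ} (hε : 0 < ε) :
    ∀ᶠ n : ℕ in atTop, ((|rhoZero p s n| : ℚ) : ℝ) ≤ (2 : ℝ) ^ (s * n) * (p : ℝ) ^ (p * n) * Real.exp (ε * n) ∧
      ∀ i : ℕ, ((|rho p s n i| : ℚ) : ℝ) ≤ (2 : ℝ) ^ (s * n) * (p : ℝ) ^ (p * n) * Real.exp (ε * n) := by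
  filter_upwards [eventually_archBound_le hp.two_le s hε] with n hn
  have hB := archBound_nonneg p s n
  have hp1 : (1 : ℚ) ≤ ((p - 1 : ℕ) : ℚ) := by exact_mod_cast (show 1 ≤ p - 1 by have := hp.two_le; omega)
  have hps : (1 : ℚ) ≤ ((p - 1 + s : ℕ) : ℚ) := by exact_mod_cast (show 1 ≤ p - 1 + s by have := hp.two_le; omega)
  have hpp : (1 : ℚ) ≤ (p : ℚ) ^ (p - 1 + s) := one_le_pow₀ (by exact_mod_cast hp.one_lt.le)
  have hn1 : (1 : ℚ) ≤ (n : ℚ) + 1 := by have := (Nat.cast_nonneg n : (0 : ℚ) ≤ n); linarith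
  -- the `ρ_i` prefactor `(n+1)` is dominated by the `ρ_0` prefactor
  have hdom : ((n : ℚ) + 1) * archBound p s n ≤ ((p - 1 : ℕ) : ℚ) * (((p - 1 + s : ℕ) : ℚ) *
      (((n : ℚ) + 1) * ((n : ℚ) + 1)) * (p : ℚ) ^ (p - 1 + s) * archBound p s n) := by
    have e : ((n : ℚ) + 1) * archBound p s n = 1 * (1 * (((n : ℚ) + 1) * 1) * 1 * archBound p s n) := by ring
    rw [e]
    gcongr
  refine ⟨le_trans (by exact_mod_cast abs_rhoZero_le hp hs n) hn, fun i => le_trans ?_ hn⟩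
  exact_mod_cast (abs_rho_le hp hs n i).trans hdom

end Literature.NumberTheory.Irrationality.LaiLupuSprang2025

end
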